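import Summits.Ventures.PercRepro.C041TriDomXJoin

/-!
# ROW C-041 — THE TWO-PAYER x-SPLIT: CONJECTURE (STOCHASTIC DOMINATION) follows from any two four-mark statements
that pay for its split at the anchor (p6, gen 49; P6-TWOEXIT-LEAN.md §53 ADDENDUM 23)

Split the cyclic functional `CycF` at a free edge `f = pq` with `p` in the double-component of `x = a₁` (if no free
edge touches it, `CycF` vanishes pointwise — `x`'s connections agree in the two colours):
`2·Σ_V CycF = Σ_{V_R} CycF(r ∨ xq, b) + Σ_{V_B} CycF(r, b ∨ xq)`, where `(r, b)` are the four-mark patterns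
`(xy, xz, xq, yz, yq, zq)` of the deletion (`rsig6` / `bsig6` with `q = u''`), `∨ xq` the join `xjoin3`
(`C041TriDomXJoin`) and `V_R ⊇ V_B` the slices.  Let `A, B : P6 → P6 → ℤ` be four-mark functionals with
 (P)  `A s t ≤ CycF (xjoin3 s) (proj3 t)`                                              on the fifteen partitions,
 (VB) `A s t + B s t ≤ CycF (xjoin3 s) (proj3 t) + CycF (proj3 s) (xjoin3 t)`,
and suppose `Σ_{ω ∈ V} A (rsig6 st ω) (bsig6 st ω) ≥ 0` and likewise for `B`, for every status, every up-set and
every fourth mark `q`.  Then `2·Σ_V CycF ≥ cntF6 A (st[f := absent]) V_R + cntF6 B (st[f := absent]) V_B ≥ 0`: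
THEOREM (TWO-PAYER SPLIT) `cycDominationS_of_payers`.  The gen-49 LP found such pairs (A = the cyclic count with
`x–q` merged in red only minus a correction `E`, B = the blue-only count plus `E`; census-true, outside every
anchored cone); this module is the kernel half of the reduction, with the pair and the two key inequalities left as
hypotheses so that any proved pair plugs in.
-/

namespace PercRepro

namespace ZoneZ

namespace MultiExit

open ZoneData Finset

variable {V₁ E₁ U₁ U₂ : Type} (Z₁ : ZoneData V₁ E₁ U₁ U₂) (u u' a₁ : V₁)

/-! ## The two key inequalities and the pointwise inequality of the split -/

/-- (P): on the red slice the conjecture's summand dominates the first payer. -/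
def PayerKeyP (A : P6 → P6 → ℤ) : Prop :=
  ∀ s ∈ valid6, ∀ t ∈ valid6, A s t ≤ CycF (xjoin3 s) (proj3 t)

/-- (VB): on the blue slice the two summands dominate the two payers. -/
def PayerKeyVB (A B : P6 → P6 → ℤ) : Prop :=
  ∀ s ∈ valid6, ∀ t ∈ valid6, A s t + B s t ≤ CycF (xjoin3 s) (proj3 t) + CycF (proj3 s) (xjoin3 t)

/-- (P) is decidable. -/
instance (A : P6 → P6 → ℤ) : Decidable (PayerKeyP A) := by unfold PayerKeyP; infer_instance

/-- (VB) is decidable. -/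
instance (A B : P6 → P6 → ℤ) : Decidable (PayerKeyVB A B) := by unfold PayerKeyVB; infer_instance

/-- The pointwise inequality of the split, with the slices. -/
theorem payer_ind_ineq {A B : P6 → P6 → ℤ} (hP : PayerKeyP A) (hVB : PayerKeyVB A B) (a b : Prop) [Decidable a]
    [Decidable b] (hba : b → a) (s t : P6) (hs : Trans6 s) (ht : Trans6 t) :
    ((if a then A s t else 0) + (if b then B s t else 0) : ℤ) ≤
      (if a then CycF (xjoin3 s) (proj3 t) else 0) + (if b then CycF (proj3 s) (xjoin3 t) else 0) := by
  have kP := hP s (trans6_mem s hs) t (trans6_mem t ht)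
  have kV := hVB s (trans6_mem s hs) t (trans6_mem t ht)
  by_cases ha : a <;> by_cases hb : b
  · simp only [ha, hb, ↓reduceIte]; exact kV
  · simp only [ha, hb, ↓reduceIte, add_zero]; exact kP
  · exact absurd (hba hb) ha
  · simp only [ha, hb, ↓reduceIte, add_zero, le_refl]

/-- The cyclic functional vanishes when the anchor's connections agree in the two colours. -/
theorem cycF_anchored : Anchored CycF := by decide

/-! ## The split -/

variable [DecidableEq E₁] [Fintype E₁]

open Classical in
/-- **The two-payer x-split**: at a free edge `f = pq` with `p` in the double-component of `x`, twice the count of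
the cyclic functional is at least the first payer's count on `V_R` plus the second payer's on `V_B`, both at the
deletion and with `q` as the fourth mark. -/
theorem two_mul_cntF_cycF_ge {A B : P6 → P6 → ℤ} (hP : PayerKeyP A) (hVB : PayerKeyVB A B) {st : E₁ → EStat}
    {f : E₁} (hf : st f = .free) {p q : V₁} (hj : Z₁.Joins f p q) (hp : p ∈ dblCompS Z₁ st a₁)
    {V : (E₁ → Bool) → Prop} (hV : UpSet V) :
    cntF6 Z₁ u u' q a₁ A (Function.update st f .absent) (sliceV V f true)
        + cntF6 Z₁ u u' q a₁ B (Function.update st f .absent) (sliceV V f false) ≤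
      2 * cntF Z₁ u u' a₁ CycF st V := by
  rw [cntF_rec Z₁ u u' a₁ CycF st f hf V]
  unfold cntF6
  rw [← Finset.sum_add_distrib, ← Finset.sum_add_distrib]
  refine Finset.sum_le_sum fun ω _ => ?_
  rw [rsig_double_xjoin3 Z₁ u u' a₁ hf ω hj hp, bsig_double_xjoin3 Z₁ u u' a₁ hf ω hj hp,
    rsig_eq_proj3 Z₁ u u' a₁ (Function.update st f .absent) ω q,
    bsig_eq_proj3 Z₁ u u' a₁ (Function.update st f .absent) ω q]
  exact payer_ind_ineq hP hVB (sliceV V f true ω) (sliceV V f false ω) (sliceV_false_le hV f ω)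
    (rsig6 Z₁ u u' q a₁ (Function.update st f .absent) ω) (bsig6 Z₁ u u' q a₁ (Function.update st f .absent) ω)
    (trans6_rsig6 Z₁ u u' q a₁ _ ω) (trans6_bsig6 Z₁ u u' q a₁ _ ω)

open Classical in
/-- **THEOREM (TWO-PAYER SPLIT)**: if two four-mark functionals satisfy the key inequalities (P) and (VB) and have
non-negative count on every up-set of every status for every fourth mark, CONJECTURE (STOCHASTIC DOMINATION) holds
on every status. -/
theorem cycDominationS_of_payers {A B : P6 → P6 → ℤ} (hP : PayerKeyP A) (hVB : PayerKeyVB A B)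
    (hA : ∀ (q : V₁) (st : E₁ → EStat) (V : (E₁ → Bool) → Prop), UpSet V → 0 ≤ cntF6 Z₁ u u' q a₁ A st V)
    (hB : ∀ (q : V₁) (st : E₁ → EStat) (V : (E₁ → Bool) → Prop), UpSet V → 0 ≤ cntF6 Z₁ u u' q a₁ B st V)
    (st : E₁ → EStat) : CycDominationS Z₁ a₁ u u' st := by
  intro V hV
  have h0 : 0 ≤ cntF Z₁ u u' a₁ CycF st V := by
    by_cases hex : ∃ f, st f = .free ∧ (Z₁.fst f ∈ dblCompS Z₁ st a₁ ∨ Z₁.snd f ∈ dblCompS Z₁ st a₁)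
    · obtain ⟨f, hf, hT⟩ := hex
      have key : ∀ (p q : V₁), Z₁.Joins f p q → p ∈ dblCompS Z₁ st a₁ → 0 ≤ cntF Z₁ u u' a₁ CycF st V := by
        intro p q hj hp
        have h1 := two_mul_cntF_cycF_ge Z₁ u u' a₁ hP hVB hf hj hp hV
        have h2 := hA q (Function.update st f .absent) _ (upSet_sliceV hV f true)
        have h3 := hB q (Function.update st f .absent) _ (upSet_sliceV hV f false)
        linarith
      rcases hT with hp | hp
      · exact key _ _ (Or.inl ⟨rfl, rfl⟩) hp
      · exact key _ _ (Or.inr ⟨rfl, rfl⟩) hp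
    · have hA' : ∀ e, st e = .free → ¬ (Z₁.fst e ∈ dblCompS Z₁ st a₁ ∨ Z₁.snd e ∈ dblCompS Z₁ st a₁) :=
        fun e he h => hex ⟨e, he, h⟩
      rw [cntF_eq_zero Z₁ u u' a₁ cycF_anchored st hA' V]
  rw [cntF_cycF_eq] at h0
  exact_mod_cast sub_nonneg.mp h0

open Classical in
/-- The all-free form: CONJECTURE (STOCHASTIC DOMINATION) on the host from two payers. -/
theorem cycDomination_of_payers {A B : P6 → P6 → ℤ} (hP : PayerKeyP A) (hVB : PayerKeyVB A B)
    (hA : ∀ (q : V₁) (st : E₁ → EStat) (V : (E₁ → Bool) → Prop), UpSet V → 0 ≤ cntF6 Z₁ u u' q a₁ A st V)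
    (hB : ∀ (q : V₁) (st : E₁ → EStat) (V : (E₁ → Bool) → Prop), UpSet V → 0 ≤ cntF6 Z₁ u u' q a₁ B st V) :
    CycDomination Z₁ a₁ u u' :=
  (cycDominationS_free Z₁ a₁ u u').mp (cycDominationS_of_payers Z₁ u u' a₁ hP hVB hA hB _)

end MultiExit

end ZoneZ

end PercRepro
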